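import Summits.QuantumFields.BalabanUV.Beta.D1BFx.RoadEnd
import Summits.QuantumFields.BalabanUV.Beta.HessKerConvCKPlug
import Summits.QuantumFields.BalabanUV.Beta.GAN24.KSlotAssembly

/-!
# `BalabanUV.Beta.D1BFx.RoadEndFromSlots` — road «BF-x» for binder row D1, composition C2 (MEAN GRADING) WITH BRIDGE B2 = (CONV-C) CUT DOWN TO THE S- AND W-SLOTS
# (`d = 3`, every `Lc ≥ 2`, adopted units `(sfStep Lc, smStep 3 Lc)`): the all-scales input `hall` of `D1BFx.RoadEnd.d1Drift_of_cesaro` / `d1Drift_iff_cesaro` /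
# `d1Drift_of_meanRoad` for an2's literal family `TbalOf Lc (JsBalOf …)` is produced from the S-slot and W-slot Cauchy rows ALONE — K-rows by gan24's END
# `GAN24.KSlotAssembly.convCKWall_holds` (p204341), rate/window merge by asym1's `HessKerConvCKPlug.exists_merged_rows`, the scalar all-scales form by asym1's
# `HessKerDressedUnitsWall.allScalesSeq_secondMoment_TbalOf_JsBalOf_unit`, BY NAME

HONEST FRAMING (cell contract, verbatim): «discharging `BetaPertH` makes Bałaban's UV stability UNCONDITIONAL — a real constructive-QFT result; it is NOT the
continuum limit and NOT the Clay problem.»  THIS MODULE DISCHARGES NOTHING of the wall beyond what `convCKWall_holds` gives: referee condition (c1) stands — bridge B2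
(= row G-an2-4) is NOT moved by this road; what is shown is that of B2 only the S- and W-slot rows are consumed by C2.  (B1_mean) and (T_mean) — the road's content —
remain HYPOTHESES, displayed.  HEADLINE: «C2 needs from row G-an2-4 only the S/W slots» — NOT «D1 closed», NOT «G-an2-4 closed», NOT BetaPertH, NOT continuum, NOT
Clay; 0 wall binders instantiated.  Claim table `HOME/b2b-balaban-beta-d1-p2/LEAVES-BFx.md` row C1–C3, sub-row C2-slots (unit `b2b-balaban-beta-d1-formalise-leaf-06`).
ABSOLUTE RULE (cell, verbatim): «No internally-minted statement may enter as a cited fact. Every hypothesis is either kernel-proved in this package or a verbatim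
quotation of a PUBLISHED theorem with page reference.»  Nothing is cited; no `def … : Prop`; every input is a tree theorem imported BY NAME.

CONTENT (all [our object]; `d = 3`, `2 ≤ Lc`): **`exists_allScalesSeq_of_slots`** (∃ κ θ, `0 ≤ θ < 1` ∧ `AllScalesSeq (j ↦ secondMoment (TbalOf Lc (JsBalOf …) j) μ ν) κ θ`
from the S- and W-slot rows), **`d1Drift_iff_cesaro_of_slots`** (the MEAN grading decides the wall: `D1Drift ↔` Cesàro means `→ stepBal`), **`d1Drift_of_meanRoad_of_slots`**
((B1_mean) + (T_mean) + S/W slots ⊢ `D1Drift Lc (JsBalOf …) N μ ν`).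
-/

namespace Summit.QuantumFields.BalabanUV.Beta.D1BFx.RoadEndFromSlots

open Finset Filter Topology
open scoped BigOperators
open Literature.MathematicalPhysics.QuantumFieldTheory.Balaban1983to89
open Literature.MathematicalPhysics.QuantumFieldTheory.Balaban1983to89.Beta
open RemainderConstAllScales (AllScalesSeq)
open ExpKernelCalculus (MKer Decays VertexFamily₂)
open OneStepResolventKernel (Fib LocStencil)
open OneStepKernelFamily (KInvStep TbalOf D1Drift)
open BalabanStepJetsSucc (JsBal0Of JsBalOf)
open Summit.QuantumFields.BalabanUV.Beta.HessKerDressedUnits (unitK unitS unitW)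
open Summit.QuantumFields.BalabanUV.Beta.HessKerDressedUnitsWall (allScalesSeq_secondMoment_TbalOf_JsBalOf_unit)
open Summit.QuantumFields.BalabanUV.Beta.HessKerConvCKPlug (exists_merged_rows)
open Summit.QuantumFields.BalabanUV.Beta.GAN24.CombesThomas (sfStep smStep sfStep_ne_zero smStep_ne_zero)
open Summit.QuantumFields.BalabanUV.Beta.GAN24.KSlotAssembly (convCKWall_holds)
open Summit.QuantumFields.BalabanUV.Beta.D1BFx.RoadEnd (d1Drift_iff_cesaro d1Drift_of_meanRoad)

noncomputable section

variable {Lc : ℕ} [NeZero Lc] (hLc : 1 ≤ Lc) (cE cVH cΛ : ℝ)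
  (W : ℕ → Fin (3 + 1) → (Fin (3 + 1) → ℤ) → Fin (3 + 1) → (Fin (3 + 1) → ℤ) → MKer (3 + 1) (Fib 3))
  (Cw' δw : ℕ → ℝ) (hδw : ∀ j, 0 < δw j) (hW' : ∀ j, VertexFamily₂ (W j) Lc (Cw' j) (δw j)) {Cs cS δS θS Cw cW δW θW : ℝ}

/-- **THE SCALAR ALL-SCALES BOUND OF THE WALL's STEP COEFFICIENTS FROM THE S- AND W-SLOT ROWS ALONE** (`d = 3`, `2 ≤ Lc`, adopted units): there are `κ` and
`θ ∈ [0,1)` with `AllScalesSeq (j ↦ secondMoment (TbalOf Lc (JsBalOf …) j) μ ν) κ θ` — asym1's `allScalesSeq_secondMoment_TbalOf_JsBalOf_unit` fed by the K-rows of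
`convCKWall_holds` and the merged S- and W-rows of `exists_merged_rows`. [our object] -/
theorem exists_allScalesSeq_of_slots (hLc2 : 2 ≤ Lc)
    (hS : ∀ j, LocStencil (unitS (sfStep Lc j) (smStep 3 Lc j) (JsBal0Of hLc cE cVH cΛ W Cw' δw hδw hW' j).S) Cs δS)
    (hSall : ∀ k j, LocStencil (unitS (sfStep Lc (k + j)) (smStep 3 Lc (k + j)) (JsBal0Of hLc cE cVH cΛ W Cw' δw hδw hW' (k + j)).S -
      unitS (sfStep Lc k) (smStep 3 Lc k) (JsBal0Of hLc cE cVH cΛ W Cw' δw hδw hW' k).S) (cS * θS ^ k) δS)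
    (hW : ∀ j, VertexFamily₂ (unitW (sfStep Lc j) (smStep 3 Lc j) (W j)) Lc Cw δW)
    (hWall : ∀ k j, VertexFamily₂ (unitW (sfStep Lc (k + j)) (smStep 3 Lc (k + j)) (W (k + j)) - unitW (sfStep Lc k) (smStep 3 Lc k) (W k)) Lc
      (cW * θW ^ k) δW)
    (hδS : 0 < δS) (hδW : 0 < δW) (hθS0 : 0 ≤ θS) (hθS1 : θS < 1) (hθW0 : 0 ≤ θW) (hθW1 : θW < 1) (μ ν : Fin 4) :
    ∃ κ θ : ℝ, 0 ≤ θ ∧ θ < 1 ∧ AllScalesSeq (fun j => B12Beta.secondMoment (TbalOf Lc (JsBalOf hLc cE cVH cΛ W Cw' δw hδw hW') j) μ ν) κ θ := by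
  obtain ⟨C, δK, cK, θ, R, hR, hRK, hRS, hRW, hθ0, hθ1, hK, hKall, hSall', hWall'⟩ :=
    exists_merged_rows (Lc := Lc) (convCKWall_holds hLc2)
      (S := fun j => unitS (sfStep Lc j) (smStep 3 Lc j) (JsBal0Of hLc cE cVH cΛ W Cw' δw hδw hW' j).S)
      (W := fun j => unitW (sfStep Lc j) (smStep 3 Lc j) (W j)) hSall hWall hδS hδW hθS0 hθS1 hθW0 hθW1
  exact ⟨_, θ, hθ0, hθ1, allScalesSeq_secondMoment_TbalOf_JsBalOf_unit hLc cE cVH cΛ W Cw' δw hδw hW' (sfStep Lc) (smStep 3 Lc) sfStep_ne_zero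
    smStep_ne_zero hK hKall hS hSall' hW hWall' hR (by linarith) hRS hRW μ ν⟩

/-- **C2, IFF FORM, WITH B2 CUT DOWN TO THE S- AND W-SLOTS**: given only the S- and W-slot Cauchy rows of row G-an2-4, THE WALL's LITERAL TERM
`D1Drift Lc (JsBalOf …) N μ ν` holds IFF the Cesàro means of the step coefficients tend to `stepBal N Lc`. [our object] -/
theorem d1Drift_iff_cesaro_of_slots (hLc2 : 2 ≤ Lc)
    (hS : ∀ j, LocStencil (unitS (sfStep Lc j) (smStep 3 Lc j) (JsBal0Of hLc cE cVH cΛ W Cw' δw hδw hW' j).S) Cs δS)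
    (hSall : ∀ k j, LocStencil (unitS (sfStep Lc (k + j)) (smStep 3 Lc (k + j)) (JsBal0Of hLc cE cVH cΛ W Cw' δw hδw hW' (k + j)).S -
      unitS (sfStep Lc k) (smStep 3 Lc k) (JsBal0Of hLc cE cVH cΛ W Cw' δw hδw hW' k).S) (cS * θS ^ k) δS)
    (hW : ∀ j, VertexFamily₂ (unitW (sfStep Lc j) (smStep 3 Lc j) (W j)) Lc Cw δW)
    (hWall : ∀ k j, VertexFamily₂ (unitW (sfStep Lc (k + j)) (smStep 3 Lc (k + j)) (W (k + j)) - unitW (sfStep Lc k) (smStep 3 Lc k) (W k)) Lc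
      (cW * θW ^ k) δW)
    (hδS : 0 < δS) (hδW : 0 < δW) (hθS0 : 0 ≤ θS) (hθS1 : θS < 1) (hθW0 : 0 ≤ θW) (hθW1 : θW < 1) (μ ν : Fin 4) (N : ℝ) :
    D1Drift Lc (JsBalOf hLc cE cVH cΛ W Cw' δw hδw hW') N μ ν ↔
      Tendsto (fun m : ℕ => (∑ j ∈ range m, B12Beta.secondMoment (TbalOf Lc (JsBalOf hLc cE cVH cΛ W Cw' δw hδw hW') j) μ ν) / (m : ℝ)) atTop
        (𝓝 (B12Normalization.stepBal N Lc)) := by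
  obtain ⟨κ, θ, hθ0, hθ1, hall⟩ := exists_allScalesSeq_of_slots hLc cE cVH cΛ W Cw' δw hδw hW' hLc2 hS hSall hW hWall hδS hδW hθS0 hθS1 hθW0 hθW1 μ ν
  exact d1Drift_iff_cesaro _ hall hθ0 hθ1 N

/-- **C2 (MEAN GRADING, ROAD FORM) WITH B2 CUT DOWN TO THE S- AND W-SLOTS**: (B1_mean) a Cesàro-null telescoping defect of the step coefficients against a
one-shot coefficient `c (Lc^m)`, (T_mean) the mean one-shot law `c (Lc^m)/m → stepBal N Lc`, and the S- and W-slot Cauchy rows ⊢ `D1Drift Lc (JsBalOf …) N μ ν`.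
[our object] -/
theorem d1Drift_of_meanRoad_of_slots (hLc2 : 2 ≤ Lc)
    (hS : ∀ j, LocStencil (unitS (sfStep Lc j) (smStep 3 Lc j) (JsBal0Of hLc cE cVH cΛ W Cw' δw hδw hW' j).S) Cs δS)
    (hSall : ∀ k j, LocStencil (unitS (sfStep Lc (k + j)) (smStep 3 Lc (k + j)) (JsBal0Of hLc cE cVH cΛ W Cw' δw hδw hW' (k + j)).S -
      unitS (sfStep Lc k) (smStep 3 Lc k) (JsBal0Of hLc cE cVH cΛ W Cw' δw hδw hW' k).S) (cS * θS ^ k) δS)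
    (hW : ∀ j, VertexFamily₂ (unitW (sfStep Lc j) (smStep 3 Lc j) (W j)) Lc Cw δW)
    (hWall : ∀ k j, VertexFamily₂ (unitW (sfStep Lc (k + j)) (smStep 3 Lc (k + j)) (W (k + j)) - unitW (sfStep Lc k) (smStep 3 Lc k) (W k)) Lc
      (cW * θW ^ k) δW)
    (hδS : 0 < δS) (hδW : 0 < δW) (hθS0 : 0 ≤ θS) (hθS1 : θS < 1) (hθW0 : 0 ≤ θW) (hθW1 : θW < 1) (μ ν : Fin 4) (N : ℝ) (c : ℕ → ℝ)
    (hB1 : Tendsto (fun m : ℕ => ((∑ j ∈ range m, B12Beta.secondMoment (TbalOf Lc (JsBalOf hLc cE cVH cΛ W Cw' δw hδw hW') j) μ ν) - c (Lc ^ m)) /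
      (m : ℝ)) atTop (𝓝 0))
    (hT : Tendsto (fun m : ℕ => c (Lc ^ m) / (m : ℝ)) atTop (𝓝 (B12Normalization.stepBal N Lc))) :
    D1Drift Lc (JsBalOf hLc cE cVH cΛ W Cw' δw hδw hW') N μ ν := by
  obtain ⟨κ, θ, hθ0, hθ1, hall⟩ := exists_allScalesSeq_of_slots hLc cE cVH cΛ W Cw' δw hδw hW' hLc2 hS hSall hW hWall hδS hδW hθS0 hθS1 hθW0 hθW1 μ ν
  exact d1Drift_of_meanRoad _ hall hθ0 hθ1 N c hB1 hT

end

end Summit.QuantumFields.BalabanUV.Beta.D1BFx.RoadEndFromSlots
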